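import Mathlib
import Summits.ValiantsHypothesis.ValiantsHypothesis.Theorems.NewtonUnitEquationsTwoProductsConfinedTameLawDefs
import Summits.ValiantsHypothesis.ValiantsHypothesis.Theorems.NewtonUnitEquationsTwoProductsRaySplitDefs
import Summits.ValiantsHypothesis.ValiantsHypothesis.Theorems.TwoProducts.Negative.DirectionsPadding
import HarnessLib

/-!
# NEGATIVE lane (val-neg-1 g5): DIRECTION GADGETS — `C+1` deep common coincidence gadgets in pairwise non-parallel directions

Helper file for crux `stmt-ValiantsHypothesis-5906` (filed `--supports`; closes NO item, proves NO summit statement, does NOT prove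
`TwoProducts`, `PlanarCellBound`, any `ResidualLawV…`, `RaySplitLaw`, a Stage-2 ray-split law or VP ≠ VNP; 0 `def`s).

The move (G3′): append to both sides the SAME `2(C+1)` binomial factors `X^{d(4i+1)} + X^{d(4i+2)}` and `X^{d(4i+3)} + X^{d(4i+4)}`,
`d(α) = Nα·s + e₀` (`s` = sum of all letters, `e₀` a unit vector with `s × e₀ ≠ 0`, `N` large for the finitely many cell witnesses).
`logDiff` is unchanged, every cell family is kept (`DirectionsPadding.isCellFamily_append_common_below`), and gadget `i` carries the
coincidence `(d(4i+1) | d(4i+4)) ~ (d(4i+2) | d(4i+3))`, which MOVES the letter `d(4i+1)`: every letter set `L` outside which coincidences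
preserve letter multiplicities (`R10Defs.LetterConfined _ L`) must contain `d(4i+1)` (`mem_of_letterConfined`), and the `C+1` letters
`d(4i+1)` are pairwise non-parallel, so they lie on no `K ≤ C` rays (`not_onRays_of_directions`, pigeonhole on `ι`; parallel rays allowed).
Hence the complement of a «ray letters `L` on `K ≤ C` rays, free letters confined» hypothesis class (R11 Stage 2 as typed by val-idea-crit-8
g2, `RaySplitFreeStructure`) is reachable from every instance at the cost `m ↦ m + 2(C+1)`, `t` unchanged.  [folklore]
-/

namespace Summit.ValiantsHypothesis.Theorems.TwoProducts.Negative.DirectionGadgets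

open Finset MvPolynomial
open Summit.ValiantsHypothesis.ValiantsHypothesis.Theorems.NewtonUnitEquations.TwoProducts.FormalLogLinearisation
open Summit.ValiantsHypothesis.ValiantsHypothesis.Theorems.NewtonUnitEquations.TwoProducts.PlanarCell
open Summit.ValiantsHypothesis.ValiantsHypothesis.Theorems.NewtonUnitEquations.TwoProducts.PermutationType (msetT)
open Summit.ValiantsHypothesis.ValiantsHypothesis.Theorems.NewtonUnitEquations.TwoProducts.PermutationType.R10Defs (LetterConfined)
open Summit.ValiantsHypothesis.ValiantsHypothesis.Theorems.NewtonUnitEquations.TwoProducts.RaySplit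
open Summit.ValiantsHypothesis.Theorems.TwoProducts.Negative.CommonPadding
open Summit.ValiantsHypothesis.Theorems.TwoProducts.Negative.ClassCoverBound (sum_swap)
open Summit.ValiantsHypothesis.Theorems.TwoProducts.Negative.TwoLetterEscape (msetT_swap)
open Summit.ValiantsHypothesis.Theorems.TwoProducts.Negative.HugeCapResidual (eventually_natMul_lt)
open Summit.ValiantsHypothesis.Theorems.TwoProducts.Negative.DirectionsPadding (isCellFamily_append_common_below)

variable {m : ℕ}

/-! ### (1) Pairwise non-parallel letters lie on no `K ≤ C` rays (core form: no `IndepRays`, no `RayCrossFree`) -/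

/-- `C+1` pairwise non-parallel letters of `T` cannot all be multiples of `K ≤ C` ray generators (parallel generators allowed):
two of them share a ray index and are then parallel. [folklore] -/
theorem not_onRays_of_directions {K C : ℕ} (hK : K ≤ C) (g : Fin K → Expo) (ι : Expo → Fin K) (ν : Expo → ℕ) (T : Finset Expo)
    (d : Fin (C + 1) → Expo) (hd : ∀ i, d i ∈ T) (hnp : ∀ i i', i ≠ i' → d i 0 * d i' 1 ≠ d i 1 * d i' 0) :
    ¬ OnRays g ι ν T := by
  intro hon
  have hcard : Fintype.card (Fin K) < Fintype.card (Fin (C + 1)) := by simp only [Fintype.card_fin]; omega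
  obtain ⟨i, i', hne, hι⟩ := Fintype.exists_ne_map_eq_of_card_lt (fun i => ι (d i)) hcard
  have hi : d i = ν (d i) • g (ι (d i)) := hon (d i) (hd i)
  have hi' : d i' = ν (d i') • g (ι (d i')) := hon (d i') (hd i')
  have hc : ∀ c : Fin 2, d i c = ν (d i) * g (ι (d i)) c := fun c => by
    conv_lhs => rw [hi]
    rw [Finsupp.smul_apply, smul_eq_mul]
  have hc' : ∀ c : Fin 2, d i' c = ν (d i') * g (ι (d i)) c := fun c => by
    conv_lhs => rw [hi']
    rw [Finsupp.smul_apply, smul_eq_mul]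
    have hι' : ι (d i') = ι (d i) := hι.symm
    rw [hι']
  exact hnp i i' hne (by rw [hc 0, hc 1, hc' 0, hc' 1]; ring)

/-! ### (2) A letter moved by a two-position coincidence lies in every confining letter set -/

/-- If positions `p ≠ q` carry letters `a, b` and `c, d` with `a + d = b + c`, `a ≠ 0`, `a ≠ b`, `a ≠ c`, then the coincidence
`(a | d) ~ (b | c)` changes the multiplicity of `a`, so `a ∈ L` whenever coincidences preserve multiplicities outside `L`. [folklore] -/
theorem mem_of_letterConfined {n : ℕ} {A : Fin n → Finset Expo} {L : Finset Expo} (hL : LetterConfined A L) {p q : Fin n}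
    (hpq : p ≠ q) {a b c d : Expo} (ha : a ∈ A p) (hb : b ∈ A p) (hc : c ∈ A q) (hd : d ∈ A q) (hsum : a + d = b + c)
    (ha0 : a ≠ 0) (hab : a ≠ b) (hac : a ≠ c) : a ∈ L := by
  classical
  by_contra haL
  have h := hL _ (swap_mem_tuples' hpq (Finset.mem_insert_of_mem ha) (Finset.mem_insert_of_mem hd)) _
    (swap_mem_tuples' hpq (Finset.mem_insert_of_mem hb) (Finset.mem_insert_of_mem hc))
    (by rw [sum_swap, sum_swap, hsum]) a haL
  rw [msetT_swap hpq, msetT_swap hpq, if_neg ha0] at h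
  have h1 : (1 : ℕ) ≤ (Finsupp.single a 1 + (if d = 0 then 0 else Finsupp.single d 1) : Expo →₀ ℕ) a := by
    rw [Finsupp.add_apply, Finsupp.single_eq_same]
    exact Nat.le_add_right _ _
  have hite : ∀ x : Expo, x ≠ a → ((if x = 0 then 0 else Finsupp.single x 1 : Expo →₀ ℕ)) a = 0 := by
    intro x hx
    by_cases hx0 : x = 0
    · rw [if_pos hx0, Finsupp.zero_apply]
    · rw [if_neg hx0, Finsupp.single_apply, if_neg hx]
  have h2 : ((if b = 0 then 0 else Finsupp.single b 1) + (if c = 0 then 0 else Finsupp.single c 1) : Expo →₀ ℕ) a = 0 := by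
    rw [Finsupp.add_apply, hite b (Ne.symm hab), hite c (Ne.symm hac)]
  rw [h, h2] at h1
  exact Nat.not_succ_le_zero 0 h1

/-! ### (3) Binomials -/

/-- Support of a binomial with distinct exponents. [folklore] -/
theorem support_binomial {a b : Expo} (hab : a ≠ b) : ((monomial a (1 : ℂ)) + monomial b 1).support = {a, b} := by
  classical
  ext e
  rw [mem_support_iff, coeff_add, coeff_monomial, coeff_monomial, Finset.mem_insert, Finset.mem_singleton]
  constructor
  · intro h
    by_contra hne
    push Not at hne
    rw [if_neg (Ne.symm hne.1), if_neg (Ne.symm hne.2), add_zero] at h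
    exact h rfl
  · rintro (rfl | rfl)
    · rw [if_pos rfl, if_neg (Ne.symm hab)]; norm_num
    · rw [if_neg hab, if_pos rfl]; norm_num

/-- A binomial with non-zero exponents is normalised and 2-sparse. [folklore] -/
theorem norm_binomial {t : ℕ} (ht : 2 ≤ t) {a b : Expo} (hab : a ≠ b) (ha : a ≠ 0) (hb : b ≠ 0) :
    coeff 0 ((monomial a (1 : ℂ)) + monomial b 1) = 0 ∧ ((monomial a (1 : ℂ)) + monomial b 1).support.card ≤ t := by
  refine ⟨?_, ?_⟩
  · rw [coeff_add, coeff_monomial, coeff_monomial, if_neg ha, if_neg hb, add_zero]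
  · rw [support_binomial hab, Finset.card_pair hab]
    exact ht

/-! ### (4) The direction-gadgets padding of an instance -/

/-- **Direction gadgets padding.**  A cell family `S ≠ ∅` of a normalised `t`-sparse pair on `m` positions (`t ≥ 2`) is a cell family of a
normalised `t`-sparse pair on `m + ((C+1) + (C+1))` positions whose letter family carries, for each `i ≤ C`, a two-position coincidence
moving a letter `d i` (so `d i` lies in every confining letter set of this family AND of every family obtained by appending further
positions, see `mem_of_letterConfined`), the `d i` pairwise non-parallel; all old letters are kept. [folklore] -/
theorem directionGadgets_padding (C : ℕ) {t : ℕ} (ht : 2 ≤ t) (u v : Fin m → MvPolynomial (Fin 2) ℂ)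
    (hu : ∀ j, coeff 0 (u j) = 0 ∧ (u j).support.card ≤ t) (hv : ∀ j, coeff 0 (v j) = 0 ∧ (v j).support.card ≤ t)
    (R : Expo → Expo → Prop) (S : Finset Expo) (hS : IsCellFamily u v R S) (hne : S.Nonempty) :
    ∃ w : Fin (C + 1 + (C + 1)) → MvPolynomial (Fin 2) ℂ, ∃ R₀ : Expo → Expo → Prop,
      (∀ j, coeff 0 (Fin.append u w j) = 0 ∧ (Fin.append u w j).support.card ≤ t) ∧
      (∀ j, coeff 0 (Fin.append v w j) = 0 ∧ (Fin.append v w j).support.card ≤ t) ∧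
      IsCellFamily (Fin.append u w) (Fin.append v w) R₀ S ∧
      tailSupport u v ⊆ tailSupport (Fin.append u w) (Fin.append v w) ∧
      ∃ d : Fin (C + 1) → Expo,
        (∀ i, d i ∈ tailSupport (Fin.append u w) (Fin.append v w)) ∧
        (∀ i i', i ≠ i' → d i 0 * d i' 1 ≠ d i 1 * d i' 0) ∧
        ∀ i, ∃ p q : Fin (C + 1 + (C + 1)), p ≠ q ∧ ∃ b c d' : Expo,
          (w p).support = {d i, b} ∧ (w q).support = {c, d'} ∧ d i + d' = b + c ∧ d i ≠ 0 ∧ d i ≠ b ∧ d i ≠ c := by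
  classical
  have hu0 : ∀ j, coeff 0 (u j) = 0 := fun j => (hu j).1
  have hv0 : ∀ j, coeff 0 (v j) = 0 := fun j => (hv j).1
  have hT := tailSupport_nonempty_of_isCellFamily hS hne
  have hs0 := tailSum_ne_zero hu0 hv0 hT
  obtain ⟨s, hs⟩ : ∃ s : Expo, s = ∑ f ∈ tailSupport u v, f := ⟨_, rfl⟩
  rw [← hs] at hs0
  -- a unit vector transversal to `s`
  obtain ⟨e₀, he₀, hcross⟩ : ∃ e₀ : Expo, (e₀ 0 = 1 ∧ e₀ 1 = 0 ∨ e₀ 0 = 0 ∧ e₀ 1 = 1) ∧ s 0 * e₀ 1 ≠ s 1 * e₀ 0 := by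
    by_cases h1 : s 1 = 0
    · have h0 : s 0 ≠ 0 := by
        intro h0; apply hs0; ext c; fin_cases c
        · simpa using h0
        · simpa using h1
      refine ⟨Finsupp.single 1 1, Or.inr ⟨by simp, by simp⟩, ?_⟩
      simpa [Finsupp.single_apply, h1] using h0
    · refine ⟨Finsupp.single 0 1, Or.inl ⟨by simp, by simp⟩, ?_⟩
      simpa [Finsupp.single_apply] using Ne.symm h1
  have hspos : 0 < s 0 + s 1 := by
    obtain ⟨c, hc⟩ := Finsupp.ne_iff.mp hs0
    fin_cases c <;> simp only [Finsupp.coe_zero, Pi.zero_apply, Fin.zero_eta, Fin.isValue, Fin.mk_one] at hc <;> omega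
  -- the cell witnesses and the depth `N`
  choose ξ hval htop hR using fun l : S => hS l.1 l.2
  have hsneg : ∀ l : S, wt (ξ l) s < 0 := fun l => hs ▸ wt_tailSum_neg (hval l) hT
  have ev : ∀ p ∈ S.attach ×ˢ tailSupport u v, ∀ᶠ N : ℕ in Filter.atTop,
      (N : ℝ) * wt (ξ p.1) s < wt (ξ p.1) p.2 - wt (ξ p.1) e₀ := by
    intro p hp
    exact eventually_natMul_lt (hsneg p.1) _
  obtain ⟨N, hN, hN1⟩ := (((Filter.eventually_all_finset _).2 ev).and (Filter.eventually_ge_atTop 1)).exists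
  -- the letters `dd α = Nα·s + e₀`
  obtain ⟨dd, hdd⟩ : ∃ dd : ℕ → Expo, dd = fun α : ℕ => (N * α) • s + e₀ := ⟨_, rfl⟩
  have hdc : ∀ α (c : Fin 2), dd α c = N * α * s c + e₀ c := fun α c => by
    simp only [hdd, Finsupp.add_apply, Finsupp.smul_apply, smul_eq_mul]
  have hd0 : ∀ α, dd α ≠ 0 := by
    intro α h
    rcases he₀ with ⟨h0, -⟩ | ⟨-, h1⟩
    · have h' := congrArg (fun e : Expo => e 0) h
      simp only [hdc, h0, Finsupp.coe_zero, Pi.zero_apply] at h'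
      exact Nat.add_one_ne_zero _ h'
    · have h' := congrArg (fun e : Expo => e 1) h
      simp only [hdc, h1, Finsupp.coe_zero, Pi.zero_apply] at h'
      exact Nat.add_one_ne_zero _ h'
  -- pairwise non-parallel (hence pairwise distinct)
  have hnp : ∀ α α', α ≠ α' → dd α 0 * dd α' 1 ≠ dd α 1 * dd α' 0 := by
    intro α α' hαα' h
    have key : ((dd α 0 : ℤ) * dd α' 1 - dd α 1 * dd α' 0) =
        (N : ℤ) * ((α : ℤ) - α') * ((s 0 : ℤ) * e₀ 1 - s 1 * e₀ 0) := by
      simp only [hdc]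
      push_cast
      ring
    have hz : ((dd α 0 : ℤ) * dd α' 1 - dd α 1 * dd α' 0) = 0 := by
      rw [sub_eq_zero]
      exact_mod_cast h
    rw [hz] at key
    rcases mul_eq_zero.1 key.symm with h1 | h1
    · rcases mul_eq_zero.1 h1 with h2 | h2
      · have : N = 0 := by exact_mod_cast h2
        omega
      · apply hαα'
        have : (α : ℤ) = α' := by linarith
        exact_mod_cast this
    · apply hcross
      have : (s 0 : ℤ) * e₀ 1 = s 1 * e₀ 0 := by linarith
      exact_mod_cast this
  have hne' : ∀ α α', α ≠ α' → dd α ≠ dd α' := by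
    intro α α' h heq
    exact hnp α α' h (by rw [heq]; ring)
  -- the coincidence identity of gadget `i`
  have hsum : ∀ i : ℕ, dd (4 * i + 1) + dd (4 * i + 4) = dd (4 * i + 2) + dd (4 * i + 3) := by
    intro i
    simp only [hdd]
    rw [add_add_add_comm, add_add_add_comm ((N * (4 * i + 2)) • s), ← add_nsmul, ← add_nsmul]
    congr 2
    ring
  -- the factors
  obtain ⟨wp, hwp⟩ : ∃ wp : Fin (C + 1) → MvPolynomial (Fin 2) ℂ, wp = fun i : Fin (C + 1) =>
      monomial (dd (4 * (i : ℕ) + 1)) (1 : ℂ) + monomial (dd (4 * (i : ℕ) + 2)) 1 := ⟨_, rfl⟩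
  obtain ⟨wq, hwq⟩ : ∃ wq : Fin (C + 1) → MvPolynomial (Fin 2) ℂ, wq = fun i : Fin (C + 1) =>
      monomial (dd (4 * (i : ℕ) + 3)) (1 : ℂ) + monomial (dd (4 * (i : ℕ) + 4)) 1 := ⟨_, rfl⟩
  obtain ⟨w, hw⟩ : ∃ w : Fin (C + 1 + (C + 1)) → MvPolynomial (Fin 2) ℂ, w = Fin.append wp wq := ⟨_, rfl⟩
  have hwpsupp : ∀ i : Fin (C + 1), (wp i).support = {dd (4 * (i : ℕ) + 1), dd (4 * (i : ℕ) + 2)} := fun i => by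
    rw [hwp]; exact support_binomial (hne' _ _ (by omega))
  have hwqsupp : ∀ i : Fin (C + 1), (wq i).support = {dd (4 * (i : ℕ) + 3), dd (4 * (i : ℕ) + 4)} := fun i => by
    rw [hwq]; exact support_binomial (hne' _ _ (by omega))
  have hwn : ∀ j, coeff 0 (w j) = 0 ∧ (w j).support.card ≤ t := by
    intro j
    rw [hw]
    refine Fin.addCases (fun i => ?_) (fun i => ?_) j
    · rw [Fin.append_left, hwp]; exact norm_binomial ht (hne' _ _ (by omega)) (hd0 _) (hd0 _)
    · rw [Fin.append_right, hwq]; exact norm_binomial ht (hne' _ _ (by omega)) (hd0 _) (hd0 _)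
  -- every new letter is some `dd α`, `α ≥ 1`
  have hmemW : ∀ e, e ∈ tailSupport w w → ∃ α, 1 ≤ α ∧ e = dd α := by
    intro e he
    simp only [tailSupport, Finset.mem_union, Finset.mem_biUnion, Finset.mem_univ, true_and, or_self] at he
    obtain ⟨j, hj⟩ := he
    revert hj
    rw [hw]
    refine Fin.addCases (fun i => ?_) (fun i => ?_) j
    · rw [Fin.append_left, hwpsupp, Finset.mem_insert, Finset.mem_singleton]
      rintro (h | h)
      · exact ⟨_, by omega, h⟩
      · exact ⟨_, by omega, h⟩
    · rw [Fin.append_right, hwqsupp, Finset.mem_insert, Finset.mem_singleton]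
      rintro (h | h)
      · exact ⟨_, by omega, h⟩
      · exact ⟨_, by omega, h⟩
  have hmemW' : ∀ i : Fin (C + 1), dd (4 * (i : ℕ) + 1) ∈ tailSupport w w := by
    intro i
    simp only [tailSupport, Finset.mem_union, Finset.mem_biUnion, Finset.mem_univ, true_and, or_self]
    refine ⟨Fin.castAdd (C + 1) i, ?_⟩
    rw [hw, Fin.append_left, hwpsupp]
    exact Finset.mem_insert_self _ _
  -- weights of the new letters
  have hwt : ∀ (l : S) (α : ℕ), wt (ξ l) (dd α) = ((N * α : ℕ) : ℝ) * wt (ξ l) s + wt (ξ l) e₀ := by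
    intro l α
    rw [hdd]
    simp only [wt_add, wt_nsmul]
  have hdeep : ∀ (l : S), ∀ e ∈ tailSupport u v, ∀ α, 1 ≤ α → wt (ξ l) (dd α) < wt (ξ l) e := by
    intro l e he α hα
    have h1 := hN (l, e) (Finset.mem_product.2 ⟨Finset.mem_attach _ _, he⟩)
    have h2 : ((N * α : ℕ) : ℝ) * wt (ξ l) s ≤ (N : ℝ) * wt (ξ l) s :=
      mul_le_mul_of_nonpos_right (by exact_mod_cast Nat.le_mul_of_pos_right N hα) (hsneg l).le
    rw [hwt]
    simp only at h1
    linarith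
  refine ⟨w, _, norm_append u w hu hwn, norm_append v w hv hwn,
    isCellFamily_append_common_below u v w (fun e e' => e' 0 + e' 1 ≤ e 0 + e 1) R S ?_, ?_,
    fun i => dd (4 * (i : ℕ) + 1), ?_, ?_, ?_⟩
  · intro l hl
    obtain ⟨e₁, he₁⟩ := id hT
    refine ⟨ξ ⟨l, hl⟩, hval ⟨l, hl⟩, ?_, htop ⟨l, hl⟩, hR ⟨l, hl⟩, ?_, ?_⟩
    · refine ⟨fun j e he => ?_, fun j e he => ?_⟩ <;>
      · obtain ⟨α, hα, rfl⟩ := hmemW e (by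
          simp only [tailSupport, Finset.mem_union, Finset.mem_biUnion, Finset.mem_univ, true_and, or_self]
          exact ⟨j, he⟩)
        exact (hdeep ⟨l, hl⟩ e₁ he₁ α hα).trans (wt_neg_of_mem_tailSupport (hval ⟨l, hl⟩) he₁)
    · intro e he e' he'
      obtain ⟨α, hα, rfl⟩ := hmemW e' he'
      exact hdeep ⟨l, hl⟩ e he α hα
    · intro e he e' he'
      obtain ⟨α, hα, rfl⟩ := hmemW e he
      obtain ⟨α', hα', rfl⟩ := hmemW e' he'
      have lhs : dd α' 0 + dd α' 1 ≤ dd α 0 + dd α 1 ↔ N * α' ≤ N * α := by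
        simp only [hdc]
        constructor
        · intro h
          exact Nat.le_of_mul_le_mul_right (by linarith) hspos
        · intro h
          have := Nat.mul_le_mul_right (s 0 + s 1) h
          linarith
      have rhs : wt (ξ ⟨l, hl⟩) (dd α) ≤ wt (ξ ⟨l, hl⟩) (dd α') ↔ N * α' ≤ N * α := by
        simp only [hdd, wt_add, add_le_add_iff_right]
        rw [hs]
        exact wt_nsmul_tailSum_le_iff (hval ⟨l, hl⟩) hT _ _
      exact lhs.trans rhs.symm
  · intro e he
    rw [tailSupport_append]
    exact Finset.mem_union_left _ he
  · intro i
    rw [tailSupport_append]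
    exact Finset.mem_union_right _ (hmemW' i)
  · intro i i' hii'
    exact hnp _ _ (fun h => hii' (Fin.ext (by omega)))
  · intro i
    refine ⟨Fin.castAdd (C + 1) i, Fin.natAdd (C + 1) i, fun h => ?_, dd (4 * (i : ℕ) + 2), dd (4 * (i : ℕ) + 3),
      dd (4 * (i : ℕ) + 4), ?_, ?_, hsum i, hd0 _, hne' _ _ (by omega), hne' _ _ (by omega)⟩
    · have := congrArg Fin.val h
      simp only [Fin.val_castAdd, Fin.val_natAdd] at this
      omega
    · rw [hw, Fin.append_left, hwpsupp]
    · rw [hw, Fin.append_right, hwqsupp]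

end Summit.ValiantsHypothesis.Theorems.TwoProducts.Negative.DirectionGadgets
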